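import Summits.ValiantsHypothesis.ValiantsHypothesis.Theorems.KPlusLogSqLawTropicalBStaticFourSignCheckerDefs

/-!
# `TropicalB` (stmt-ValiantsHypothesis-19771) — the SIGN CHECKER for the static `4 × 4` cell: SOUNDNESS and the `14` CERTIFIED RUNS

Cell `pub-symmetroid`, seat val-sym-trop-p4 (g7).  HONEST FRAMING: pure finite combinatorics, companion of `…StaticFourSignCheckerDefs` (the
model, the conditions (D)/(H), the checker).  This file proves the checker SOUND — `check cs = true` refutes the conditions `cs` for every
integer vector `e : Fin 36 → ℤ` of block exchanges satisfying the `48` transitivity TRIPLE LAWS — and runs it (kernel evaluation,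
`decide +kernel`, ≈ 14 000 search nodes, ≈ 2 min) on the `14` orbit representatives `repT` of the quad-free `16`-subsets of `S₄`:
`rep_contradiction`.  Together with the tree's exchange-square law (p493290), diagonal bracketing and the `3 × 3` parity-class law
(`…TropicalBDiagonalBracketing`, p522470), the row/column/transposition symmetries of dominant chains (`…TropicalBRelabel`,
`…TropicalBTranspose`) and an orbit-cover lemma (next files), this is the finite heart of «a static `4 × 4` design has at most `15`
dominant terms» (located: memo `HOME/val-sym-trop-p4/g7/STATIC4-g7.md`; kernel today `15 ≤ · ≤ 17`, p515185 / p520468).  Sanity: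
`check_fifteen_false` — the checker does not refute the dominant set of the tree's `15`-term design.  Nothing here bears on `TropicalB` in
its window, `WeakLifting`, `MatrixDescartes` (stmt-ValiantsHypothesis-18050) or VP ≠ VNP.
[this seat]
-/

set_option linter.dupNamespace false
set_option autoImplicit false

namespace Summit.ValiantsHypothesis.ValiantsHypothesis.Theorems.KPlusLogSqLaw.StaticFourQuad

/-! ### semantics of literals, conditions and the triple laws for an integer vector `e : Fin 36 → ℤ` of block exchanges -/

/-- literal `(b, true)` means `0 < e b`, literal `(b, false)` means `e b < 0`. -/
def LitHolds (e : Fin 36 → ℤ) (l : Lit) : Prop :=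
  (l.2 = true → 0 < e l.1) ∧ (l.2 = false → e l.1 < 0)

/-- a branch holds when all its literals hold. -/
def BranchHolds (e : Fin 36 → ℤ) (br : Branch) : Prop :=
  ∀ l ∈ br, LitHolds e l

/-- a condition holds when one of its branches holds. -/
def CondHolds (e : Fin 36 → ℤ) (c : Cond) : Prop :=
  ∃ br ∈ c, BranchHolds e br

/-- the transitivity law of a triple `(b_uv, b_vw, b_uw)`: two positive (negative) exchanges force the third. -/
def TripleLaw (e : Fin 36 → ℤ) (t : Fin 36 × Fin 36 × Fin 36) : Prop :=
  (0 < e t.1 → 0 < e t.2.1 → 0 < e t.2.2) ∧ (e t.1 < 0 → e t.2.1 < 0 → e t.2.2 < 0)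

/-- `e` satisfies every triple law listed in `triplesOf`. -/
def Trans (e : Fin 36 → ℤ) : Prop :=
  ∀ b, ∀ t ∈ triplesOf b, TripleLaw e t

/-- an assignment is sound for `e` when all its asserted literals hold. -/
def Extends (e : Fin 36 → ℤ) (σ : Assignment) : Prop :=
  ∀ l ∈ σ, LitHolds e l

variable {e : Fin 36 → ℤ}

/-- what an asserted sign says about `e`. -/
theorem sgn_sound {σ : Assignment} (hσ : Extends e σ) {b : Fin 36} {x : Bool} (h : sgn σ b = some x) :
    (x = true → 0 < e b) ∧ (x = false → e b < 0) := by
  unfold sgn at h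
  obtain ⟨l, hl, rfl⟩ := Option.map_eq_some_iff.1 h
  have hb : l.1 = b := by simpa using List.find?_some hl
  have hmem : l ∈ σ := List.mem_of_find?_eq_some hl
  subst hb
  exact hσ l hmem

/-- two literals on the same block that both hold have the same sign. -/
theorem litHolds_unique {l l' : Lit} (h : LitHolds e l) (h' : LitHolds e l') (hb : l.1 = l'.1) : l.2 = l'.2 := by
  rcases l with ⟨b, x⟩; rcases l' with ⟨b', x'⟩
  simp only at hb; subst hb
  simp only [LitHolds] at h h'
  cases x <;> cases x' <;> simp_all <;> linarith

/-- a triple check never fails on an assignment that is sound for a transitive `e`. -/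
theorem tripleOk_of_extends {σ : Assignment} (hσ : Extends e σ) {t : Fin 36 × Fin 36 × Fin 36} (ht : TripleLaw e t) :
    tripleOk σ t = true := by
  unfold tripleOk
  rcases h1 : sgn σ t.1 with _ | x <;> rcases h2 : sgn σ t.2.1 with _ | y <;> rcases h3 : sgn σ t.2.2 with _ | z <;> try rfl
  have s1 := sgn_sound hσ h1
  have s2 := sgn_sound hσ h2
  have s3 := sgn_sound hσ h3
  rcases ht with ⟨hp, hn⟩
  cases x <;> cases y <;> cases z <;> simp_all <;> linarith

/-- **asserting a true literal succeeds** and keeps the assignment sound. -/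
theorem assertLit_sound {σ : Assignment} (hσ : Extends e σ) (hT : Trans e) {l : Lit} (hl : LitHolds e l) :
    ∃ σ', assertLit σ l = some σ' ∧ Extends e σ' := by
  unfold assertLit
  rcases h : sgn σ l.1 with _ | x
  · -- new block: all triple checks through it pass
    have hσ' : Extends e (l :: σ) := by
      intro l' hl'
      rcases List.mem_cons.1 hl' with rfl | hl'
      · exact hl
      · exact hσ l' hl'
    have hall : ((triplesOf l.1).all (tripleOk (l :: σ))) = true :=
      List.all_eq_true.2 fun t ht => tripleOk_of_extends hσ' (hT l.1 t ht)
    exact ⟨l :: σ, by simp [hall], hσ'⟩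
  · -- already asserted: the signs agree
    have s := sgn_sound hσ h
    have hx : x = l.2 := by
      rcases l with ⟨b, y⟩
      simp only [LitHolds] at hl
      simp only at s ⊢
      cases x <;> cases y <;> simp_all <;> linarith
    exact ⟨σ, by simp [hx], hσ⟩

/-- **asserting a true branch succeeds** and keeps the assignment sound. -/
theorem assertAll_sound (hT : Trans e) : ∀ (br : Branch) (σ : Assignment), Extends e σ → BranchHolds e br →
    ∃ σ', assertAll br σ = some σ' ∧ Extends e σ'
  | [], σ, hσ, _ => ⟨σ, rfl, hσ⟩
  | l :: ls, σ, hσ, hbr => by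
    obtain ⟨σ₁, h₁, hσ₁⟩ := assertLit_sound hσ hT (hbr l (by simp))
    obtain ⟨σ', h', hσ'⟩ := assertAll_sound hT ls σ₁ hσ₁ (fun l' hl' => hbr l' (by simp [hl']))
    exact ⟨σ', by simp [assertAll, h₁, h'], hσ'⟩

/-- **the search is sound**: if `dfs` certifies a contradiction from a sound assignment, the conditions cannot all hold. -/
theorem dfs_sound (hT : Trans e) : ∀ (cs : List Cond) (σ : Assignment), Extends e σ → (∀ c ∈ cs, CondHolds e c) →
    dfs cs σ = true → False
  | [], σ, _, _, h => by simp [dfs] at h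
  | c :: cs, σ, hσ, hcs, h => by
    obtain ⟨br, hbr, hholds⟩ := hcs c (by simp)
    rw [dfs, List.all_eq_true] at h
    have hb := h br hbr
    obtain ⟨σ', h', hσ'⟩ := assertAll_sound hT br σ hσ hholds
    rw [h'] at hb
    exact dfs_sound hT cs σ' hσ' (fun c' hc' => hcs c' (by simp [hc'])) hb

/-- **SOUNDNESS OF THE CHECKER**: certified conditions are contradictory for every transitive integer vector of block exchanges. -/
theorem check_sound {cs : List Cond} (h : check cs = true) (hT : Trans e) (hcs : ∀ c ∈ cs, CondHolds e c) : False :=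
  dfs_sound hT cs [] (fun _ hl => by simp at hl) hcs h

/-! ### the `14` certified runs (kernel evaluation, `decide +kernel`; ≈ 14 000 search nodes in total) -/

/-- rep `0` is contradictory. -/
theorem check_rep_0 : check (condsOf (repT 0)) = true := by decide +kernel
/-- rep `1` is contradictory. -/
theorem check_rep_1 : check (condsOf (repT 1)) = true := by decide +kernel
/-- rep `2` is contradictory. -/
theorem check_rep_2 : check (condsOf (repT 2)) = true := by decide +kernel
/-- rep `3` is contradictory. -/
theorem check_rep_3 : check (condsOf (repT 3)) = true := by decide +kernel
/-- rep `4` is contradictory. -/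
theorem check_rep_4 : check (condsOf (repT 4)) = true := by decide +kernel
/-- rep `5` is contradictory. -/
theorem check_rep_5 : check (condsOf (repT 5)) = true := by decide +kernel
/-- rep `6` is contradictory. -/
theorem check_rep_6 : check (condsOf (repT 6)) = true := by decide +kernel
/-- rep `7` is contradictory. -/
theorem check_rep_7 : check (condsOf (repT 7)) = true := by decide +kernel
/-- rep `8` is contradictory. -/
theorem check_rep_8 : check (condsOf (repT 8)) = true := by decide +kernel
/-- rep `9` is contradictory. -/
theorem check_rep_9 : check (condsOf (repT 9)) = true := by decide +kernel
/-- rep `10` is contradictory. -/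
theorem check_rep_10 : check (condsOf (repT 10)) = true := by decide +kernel
/-- rep `11` is contradictory. -/
theorem check_rep_11 : check (condsOf (repT 11)) = true := by decide +kernel
/-- rep `12` is contradictory. -/
theorem check_rep_12 : check (condsOf (repT 12)) = true := by decide +kernel
/-- rep `13` is contradictory. -/
theorem check_rep_13 : check (condsOf (repT 13)) = true := by decide +kernel

/-- **all `14` orbit representatives are contradictory.** -/
theorem check_rep (r : Fin 14) : check (condsOf (repT r)) = true := by
  fin_cases r
  exacts [check_rep_0, check_rep_1, check_rep_2, check_rep_3, check_rep_4, check_rep_5, check_rep_6, check_rep_7,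
    check_rep_8, check_rep_9, check_rep_10, check_rep_11, check_rep_12, check_rep_13]

/-- **THE FINITE HEART of «static size 4 = 15»**: for each orbit representative `V` and every integer vector `e` of block exchanges
satisfying the triple laws, the conditions (D) and (H) of `V` do not all hold. -/
theorem rep_contradiction (r : Fin 14) (hT : Trans e) (hcs : ∀ c ∈ condsOf (repT r), CondHolds e c) : False :=
  check_sound (check_rep r) hT hcs

/-- sanity: the checker does NOT refute the dominant set of the tree's `15`-term static design (`static_four_unsigned_fifteen`). -/
theorem check_fifteen_false :
    check (condsOf fun i => i ∈ [1, 3, 4, 5, 6, 7, 8, 13, 14, 15, 16, 18, 20, 21, 23]) = false := by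
  decide +kernel

end Summit.ValiantsHypothesis.ValiantsHypothesis.Theorems.KPlusLogSqLaw.StaticFourQuad
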